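import Summits.Parity.GeneralizedHardyLittlewood.Theorems.LiouvilleMADTypeIIToLevelTypeIIRect
import Summits.Parity.GeneralizedHardyLittlewood.Theorems.LiouvilleMADTypeIIToLevelEngine
import Summits.Parity.GeneralizedHardyLittlewood.Theses.LiouvilleMAD

/-!
# `TypeIILiouville` (crux stmt-Parity-13322, route `LiouvilleMAD`), line `Sketch`: Stub A

The only use of the crux in the negative line `Sketch`: `TypeIILiouville` at the shift `c = −1`, tested
against 0/1 coefficients (`𝟙_{primes in (N, 2N]} ⊗ 𝟙`), gives a power saving for the prime-progression sums
`Q_N(y) = ∑_{N < p ≤ 2N, p prime} ∑_{1 ≤ k ≤ y, p ∣ k + 1} λ(k) = ∑_p ∑_{p m ≤ y + 1} λ(p m − 1)` (`y ≥ N²`):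
`|Q_N(y)| ≤ C₁ y N^{−δ₁}` (`stub_A`).

The hyperbolic cut-off `p m ≤ y + 1` is separated by the route's own Vaughan-engine pieces:
`TypeIIToLevel.typeII_rect` (the rectangle type-II hypothesis for `Φ(k) = λ(k − 1)`, modulus `q = 1`,
`U = N`) and `TypeIIToLevel.abs_block_le` (the block `d ∈ (N, 2N]` at height `x = y + 1`, cut into
`K = ⌊N^{η'/2}⌋ + 1` short intervals), `η' = min η (1/2)`, `δ₁ = η'/2`.
-/

noncomputable section

open Finset ArithmeticFunction Filter Asymptotics

namespace Summit.Parity.GeneralizedHardyLittlewood.Theorems.TypeIILiouville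

open Summit.Parity.GeneralizedHardyLittlewood.Theses.LiouvilleMAD (TypeIILiouville)

/-- `|λ(n)| ≤ 1` as a real number (`λ(0) = 0`). -/
private theorem stubA_abs_liouville_le_one (n : ℕ) : |(liouville n : ℝ)| ≤ 1 := by
  rcases eq_or_ne n 0 with rfl | hn
  · simp
  · rw [liouville_apply hn]
    push_cast
    rw [abs_pow, abs_neg, abs_one, one_pow]

/-- The bijection `k = p m − 1` between `{m : 0 < m ≤ (y+1)/p}` and `{k ∈ [1, y] : p ∣ k + 1}` for a prime
`p`: `∑_{0 < m ≤ (y+1)/p} λ(p m − 1) = ∑_{1 ≤ k ≤ y, p ∣ k+1} λ(k)`. -/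
private theorem stubA_inner_eq {p : ℕ} (hp : p.Prime) (y : ℕ) :
    ∑ m ∈ Ioc 0 ((y + 1) / p), (liouville (p * m - 1) : ℝ) =
      ∑ k ∈ (Icc 1 y).filter (fun k => p ∣ k + 1), (liouville k : ℝ) := by
  have hp2 : 2 ≤ p := hp.two_le
  have hp0 : 0 < p := hp.pos
  refine sum_nbij' (fun m => p * m - 1) (fun k => (k + 1) / p) ?_ ?_ ?_ ?_ ?_
  · intro m hm
    rw [mem_Ioc] at hm
    have h1 : m * p ≤ y + 1 := (Nat.le_div_iff_mul_le hp0).1 hm.2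
    have h2 : 2 * 1 ≤ p * m := Nat.mul_le_mul hp2 hm.1
    have h3 : p * m = m * p := Nat.mul_comm p m
    rw [mem_filter, mem_Icc]
    refine ⟨⟨by omega, by omega⟩, ?_⟩
    rw [show p * m - 1 + 1 = p * m by omega]
    exact Dvd.intro m rfl
  · intro k hk
    rw [mem_filter, mem_Icc] at hk
    rw [mem_Ioc]
    exact ⟨Nat.div_pos (Nat.le_of_dvd (Nat.succ_pos k) hk.2) hp0, Nat.div_le_div_right (by omega)⟩
  · intro m hm
    rw [mem_Ioc] at hm
    have h2 : 2 * 1 ≤ p * m := Nat.mul_le_mul hp2 hm.1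
    show (p * m - 1 + 1) / p = m
    rw [show p * m - 1 + 1 = p * m by omega, Nat.mul_div_cancel_left m hp0]
  · intro k hk
    rw [mem_filter] at hk
    show p * ((k + 1) / p) - 1 = k
    rw [Nat.mul_div_cancel' hk.2, Nat.add_sub_cancel]
  · intro m _
    rfl

/-- `((N/2 : ℕ))^{−η'} ≤ 4 N^{−η'}` for `N ≥ 2`, `0 ≤ η' ≤ 1` (since `⌊N/2⌋ ≥ N/4`). -/
private theorem stubA_rpow_half_le {N : ℕ} (hN : 2 ≤ N) {η' : ℝ} (hη'0 : 0 ≤ η') (hη'1 : η' ≤ 1) :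
    ((N / 2 : ℕ) : ℝ) ^ (-η') ≤ 4 * (N : ℝ) ^ (-η') := by
  have hN0 : (0 : ℝ) < N := by exact_mod_cast (by omega : 0 < N)
  have h4 : (N : ℝ) / 4 ≤ ((N / 2 : ℕ) : ℝ) := by
    have h' : N ≤ 4 * (N / 2) := by omega
    have h'' : (N : ℝ) ≤ 4 * ((N / 2 : ℕ) : ℝ) := by exact_mod_cast h'
    linarith
  have h1 : ((N / 2 : ℕ) : ℝ) ^ (-η') ≤ ((N : ℝ) / 4) ^ (-η') :=
    Real.rpow_le_rpow_of_nonpos (div_pos hN0 (by norm_num)) h4 (by linarith)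
  have h2 : ((N : ℝ) / 4) ^ (-η') = (N : ℝ) ^ (-η') * (4 : ℝ) ^ η' := by
    rw [Real.div_rpow hN0.le (by norm_num), Real.rpow_neg (by norm_num : (0 : ℝ) ≤ 4), div_eq_mul_inv,
      inv_inv]
  have h3 : (4 : ℝ) ^ η' ≤ 4 := by
    calc (4 : ℝ) ^ η' ≤ (4 : ℝ) ^ (1 : ℝ) := Real.rpow_le_rpow_of_exponent_le (by norm_num) hη'1
      _ = 4 := Real.rpow_one 4
  have h0 : 0 ≤ (N : ℝ) ^ (-η') := by positivity
  rw [h2] at h1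
  calc ((N / 2 : ℕ) : ℝ) ^ (-η') ≤ (N : ℝ) ^ (-η') * (4 : ℝ) ^ η' := h1
    _ ≤ (N : ℝ) ^ (-η') * 4 := mul_le_mul_of_nonneg_left h3 h0
    _ = 4 * (N : ℝ) ^ (-η') := by ring

/-- **Stub A.** `TypeIILiouville` ⇒ a power saving for `Q_N(y) = ∑_{N<p≤2N} ∑_{k≤y, p ∣ k+1} λ(k)`
(`y ≥ N²`, `N ≥ 2`): the crux at `c = −1` against `𝟙_{primes in (N,2N]} ⊗ 𝟙`, the cut-off `p m ≤ y + 1`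
separated by `TypeIIToLevel.typeII_rect` and `TypeIIToLevel.abs_block_le`. -/
theorem stub_A (h : TypeIILiouville) :
    ∃ δ₁ : ℝ, 0 < δ₁ ∧ ∃ C₁ : ℝ, ∀ N : ℕ, 2 ≤ N → ∀ y : ℕ, N ^ 2 ≤ y →
      |∑ p ∈ (Ioc N (2 * N)).filter Nat.Prime,
          ∑ k ∈ (Icc 1 y).filter (fun k => p ∣ k + 1), (liouville k : ℝ)| ≤
        C₁ * y * (N : ℝ) ^ (-δ₁) := by
  obtain ⟨η, hη, C, hC⟩ := h (-1) (by norm_num)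
  have hη'0 : 0 < min η (1 / 2) := lt_min hη (by norm_num)
  set C' : ℝ := max C 0 with hC'
  have hC'0 : 0 ≤ C' := le_max_right _ _
  -- `Φ(k) = λ(k − 1)`: `|Φ| ≤ 1` and the dyadic bilinear bound in the grouped shape with `C' ≥ 0`
  have hΦ1 : ∀ n : ℕ, |(fun k : ℕ => (liouville (Int.toNat ((k : ℤ) + -1)) : ℝ)) n| ≤ 1 :=
    fun n => stubA_abs_liouville_le_one _
  have hΦ : ∀ M N : ℕ, 1 ≤ N → N ≤ M → ∀ α β : ℕ → ℝ,
      |∑ m ∈ Ioc M (2 * M), ∑ n ∈ Ioc N (2 * N),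
          α m * β n * (fun k : ℕ => (liouville (Int.toNat ((k : ℤ) + -1)) : ℝ)) (m * n)| ≤
        C' * Real.sqrt (∑ m ∈ Ioc M (2 * M), α m ^ 2) * Real.sqrt (∑ n ∈ Ioc N (2 * N), β n ^ 2) *
          (Real.sqrt ((M : ℝ) * N) * ((N : ℝ) ^ (-(1 / 2 : ℝ)) + (M : ℝ) ^ (-η))) := by
    intro M N hN hNM α β
    have h1 := hC M N hN hNM α β
    simp only [Nat.cast_mul] at h1 ⊢
    refine h1.trans ?_
    have hX : 0 ≤ Real.sqrt (∑ m ∈ Ioc M (2 * M), α m ^ 2) * Real.sqrt (∑ n ∈ Ioc N (2 * N), β n ^ 2) *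
        (Real.sqrt ((M : ℝ) * N) * ((N : ℝ) ^ (-(1 / 2 : ℝ)) + (M : ℝ) ^ (-η))) := by positivity
    calc C * Real.sqrt (∑ m ∈ Ioc M (2 * M), α m ^ 2) * Real.sqrt (∑ n ∈ Ioc N (2 * N), β n ^ 2) *
          Real.sqrt ((M : ℝ) * N) * ((N : ℝ) ^ (-(1 / 2 : ℝ)) + (M : ℝ) ^ (-η))
        = C * (Real.sqrt (∑ m ∈ Ioc M (2 * M), α m ^ 2) * Real.sqrt (∑ n ∈ Ioc N (2 * N), β n ^ 2) *
          (Real.sqrt ((M : ℝ) * N) * ((N : ℝ) ^ (-(1 / 2 : ℝ)) + (M : ℝ) ^ (-η)))) := by ring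
      _ ≤ C' * (Real.sqrt (∑ m ∈ Ioc M (2 * M), α m ^ 2) * Real.sqrt (∑ n ∈ Ioc N (2 * N), β n ^ 2) *
          (Real.sqrt ((M : ℝ) * N) * ((N : ℝ) ^ (-(1 / 2 : ℝ)) + (M : ℝ) ^ (-η)))) :=
          mul_le_mul_of_nonneg_right (le_max_left _ _) hX
      _ = _ := by ring
  refine ⟨min η (1 / 2) / 2, by positivity, 200 * C' + 24, fun N hN y hy => ?_⟩
  -- basic facts about `N` and `y`
  have hNpos : 0 < N := by omega
  have hN0 : (0 : ℝ) < N := by exact_mod_cast hNpos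
  have hN1r : (1 : ℝ) ≤ N := by exact_mod_cast (by omega : 1 ≤ N)
  have hNN : N * N ≤ y := by rw [sq] at hy; exact hy
  have hy4 : 4 ≤ y := le_trans (Nat.mul_le_mul hN hN) hNN
  have hy4r : (4 : ℝ) ≤ y := by exact_mod_cast hy4
  have hDU : N * N ≤ y + 1 := by omega
  have h2D : 2 * N ≤ y + 1 := le_trans (Nat.mul_le_mul_right N hN) hDU
  -- the rectangle type-II hypothesis for the progression weight (`q = 1`, `w = 0`, `U = N`)
  have hII := TypeIIToLevel.typeII_rect (Φ := fun k : ℕ => (liouville (Int.toNat ((k : ℤ) + -1)) : ℝ))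
    hη hC'0 hΦ1 hΦ Nat.one_pos 0 hN
  set η' : ℝ := min η (1 / 2) with hη'
  have hη'h : η' ≤ 1 / 2 := min_le_right _ _
  have hη'1 : η' ≤ 1 := by linarith
  set W : ℝ := (10 * C' + 1) * ((1 : ℕ) : ℝ) * ((((N / 2 : ℕ) : ℝ)) ^ (-η') + (N : ℝ) ^ (-η')) with hW
  have hW0 : 0 ≤ W := by positivity
  -- the parameters `g = N^{η'/2}`, `K = ⌊g⌋ + 1`
  set g : ℝ := (N : ℝ) ^ (η' / 2) with hg
  have hg0 : 0 < g := Real.rpow_pos_of_pos hN0 _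
  have hg1 : 1 ≤ g := Real.one_le_rpow hN1r (by positivity)
  have hgN : g ≤ N := by
    calc g ≤ (N : ℝ) ^ (1 : ℝ) := Real.rpow_le_rpow_of_exponent_le hN1r (by linarith)
      _ = N := Real.rpow_one _
  have hgi : (N : ℝ) ^ (-(η' / 2)) = g⁻¹ := Real.rpow_neg hN0.le _
  have hgi0 : 0 < g⁻¹ := inv_pos.2 hg0
  have hgi1 : g⁻¹ ≤ 1 := inv_le_one_of_one_le₀ hg1
  have hggi : g * g⁻¹ = 1 := mul_inv_cancel₀ hg0.ne'
  have hY : (N : ℝ) ^ (-η') = g⁻¹ * g⁻¹ := by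
    rw [← hgi, ← Real.rpow_add hN0]
    congr 1
    ring
  have hV : ((N / 2 : ℕ) : ℝ) ^ (-η') ≤ 4 * (g⁻¹ * g⁻¹) := by
    rw [← hY]
    exact stubA_rpow_half_le hN hη'0.le hη'1
  set K : ℕ := ⌊g⌋₊ + 1 with hK
  have hKpos : 0 < K := Nat.succ_pos _
  have hKr : (K : ℝ) = ⌊g⌋₊ + 1 := by rw [hK, Nat.cast_add, Nat.cast_one]
  have hKg1 : (K : ℝ) ≤ g + 1 := by rw [hKr]; linarith [Nat.floor_le hg0.le]
  have hgK : g ≤ K := by rw [hKr]; exact (Nat.lt_floor_add_one g).le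
  -- the progression weight and the coefficients
  set lam : ℕ → ℝ := fun k => if k ≡ 0 [MOD 1] then (liouville (Int.toNat ((k : ℤ) + -1)) : ℝ) else 0
    with hlam
  have hlam1 : ∀ n, |lam n| ≤ 1 := by
    intro n
    simp only [hlam]
    split_ifs
    · exact stubA_abs_liouville_le_one _
    · simp
  set a : ℕ → ℝ := fun d => if d.Prime then 1 else 0 with haD
  set b : ℕ → ℝ := fun _ => 1 with hbD
  have ha : ∀ d, d ≤ y + 1 → |a d| ≤ 1 := by
    intro d _
    simp only [haD]
    split_ifs <;> simp
  have hb : ∀ m, m ≤ y + 1 → |b m| ≤ 1 := fun _ _ => by simp [hbD]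
  -- the block estimate of the Vaughan engine
  have hblock := TypeIIToLevel.abs_block_le (lam := lam) (U := N) (W := W) (x := y + 1) (D := N) (K := K)
    hII hW0 le_rfl hNpos hDU h2D hKpos zero_le_one zero_le_one a b ha hb hlam1
  -- identification of the engine's sum with the prime-progression sum
  have hident : ∑ d ∈ Ioc N (2 * N), a d * ∑ m ∈ Ioc 0 ((y + 1) / d), b m * lam (d * m) =
      ∑ p ∈ (Ioc N (2 * N)).filter Nat.Prime,
        ∑ k ∈ (Icc 1 y).filter (fun k => p ∣ k + 1), (liouville k : ℝ) := by
    rw [sum_filter]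
    refine sum_congr rfl fun d _ => ?_
    by_cases hpd : d.Prime
    · rw [if_pos hpd, ← stubA_inner_eq hpd y]
      have had : a d = 1 := by simp only [haD, if_pos hpd]
      rw [had, one_mul]
      refine sum_congr rfl fun m _ => ?_
      simp only [hbD, hlam, one_mul]
      rw [if_pos Nat.modEq_one]
      have ht : Int.toNat (((d * m : ℕ) : ℤ) + -1) = d * m - 1 := by omega
      rw [ht]
    · rw [if_neg hpd]
      have had : a d = 0 := by simp only [haD, if_neg hpd]
      rw [had, zero_mul]
  -- bookkeeping
  have hyr : ((y + 1 : ℕ) : ℝ) = (y : ℝ) + 1 := by push_cast; ring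
  have hy0 : (0 : ℝ) ≤ (y : ℝ) + 1 := by positivity
  have hW5 : W ≤ 5 * (10 * C' + 1) * (g⁻¹ * g⁻¹) := by
    have h1 : ((N / 2 : ℕ) : ℝ) ^ (-η') + (N : ℝ) ^ (-η') ≤ 5 * (g⁻¹ * g⁻¹) := by rw [hY]; linarith
    calc W = (10 * C' + 1) * (((N / 2 : ℕ) : ℝ) ^ (-η') + (N : ℝ) ^ (-η')) := by
          rw [hW, Nat.cast_one, mul_one]
      _ ≤ (10 * C' + 1) * (5 * (g⁻¹ * g⁻¹)) := mul_le_mul_of_nonneg_left h1 (by positivity)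
      _ = _ := by ring
  have hKu : (K : ℝ) * (g⁻¹ * g⁻¹) ≤ 2 * g⁻¹ := by
    calc (K : ℝ) * (g⁻¹ * g⁻¹) ≤ (g + 1) * (g⁻¹ * g⁻¹) := mul_le_mul_of_nonneg_right hKg1 (by positivity)
      _ = (g * g⁻¹) * g⁻¹ + g⁻¹ * g⁻¹ := by ring
      _ = g⁻¹ + g⁻¹ * g⁻¹ := by rw [hggi, one_mul]
      _ ≤ g⁻¹ + g⁻¹ * 1 := by gcongr
      _ = 2 * g⁻¹ := by ring
  have hT1 : (K : ℝ) * (1 * 1 * W * ((y + 1 : ℕ) : ℝ)) ≤ 10 * (10 * C' + 1) * ((y : ℝ) + 1) * g⁻¹ := by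
    rw [hyr]
    calc (K : ℝ) * (1 * 1 * W * ((y : ℝ) + 1)) = (K * W) * ((y : ℝ) + 1) := by ring
      _ ≤ (K * (5 * (10 * C' + 1) * (g⁻¹ * g⁻¹))) * ((y : ℝ) + 1) :=
          mul_le_mul_of_nonneg_right (mul_le_mul_of_nonneg_left hW5 (Nat.cast_nonneg K)) hy0
      _ = 5 * (10 * C' + 1) * ((y : ℝ) + 1) * (K * (g⁻¹ * g⁻¹)) := by ring
      _ ≤ 5 * (10 * C' + 1) * ((y : ℝ) + 1) * (2 * g⁻¹) := mul_le_mul_of_nonneg_left hKu (by positivity)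
      _ = 10 * (10 * C' + 1) * ((y : ℝ) + 1) * g⁻¹ := by ring
  have hT2 : 1 * 1 * (((N / K + 1 : ℕ) : ℝ) * (((y + 1) / N : ℕ) : ℝ)) ≤ 2 * ((y : ℝ) + 1) * g⁻¹ := by
    rw [one_mul, one_mul]
    have h1 : ((N / K + 1 : ℕ) : ℝ) ≤ N * g⁻¹ + 1 := by
      have h11 : ((N / K : ℕ) : ℝ) ≤ (N : ℝ) / K := Nat.cast_div_le
      have h12 : (N : ℝ) / K ≤ N / g := div_le_div_of_nonneg_left hN0.le hg0 hgK
      have h13 : (N : ℝ) / g = N * g⁻¹ := div_eq_mul_inv _ _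
      push_cast
      linarith
    have h2 : (((y + 1) / N : ℕ) : ℝ) ≤ ((y : ℝ) + 1) * (N : ℝ)⁻¹ := by
      have h21 : (((y + 1) / N : ℕ) : ℝ) ≤ ((y + 1 : ℕ) : ℝ) / N := Nat.cast_div_le
      rw [hyr, div_eq_mul_inv] at h21
      exact h21
    have hNinv : (N : ℝ)⁻¹ ≤ g⁻¹ := (inv_le_inv₀ hN0 hg0).2 hgN
    calc ((N / K + 1 : ℕ) : ℝ) * (((y + 1) / N : ℕ) : ℝ) ≤ (N * g⁻¹ + 1) * (((y : ℝ) + 1) * (N : ℝ)⁻¹) :=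
          mul_le_mul h1 h2 (Nat.cast_nonneg _) (by positivity)
      _ = ((y : ℝ) + 1) * g⁻¹ * (N * (N : ℝ)⁻¹) + ((y : ℝ) + 1) * (N : ℝ)⁻¹ := by ring
      _ = ((y : ℝ) + 1) * g⁻¹ + ((y : ℝ) + 1) * (N : ℝ)⁻¹ := by rw [mul_inv_cancel₀ hN0.ne', mul_one]
      _ ≤ ((y : ℝ) + 1) * g⁻¹ + ((y : ℝ) + 1) * g⁻¹ := by gcongr
      _ = 2 * ((y : ℝ) + 1) * g⁻¹ := by ring
  have hfin : (K : ℝ) * (1 * 1 * W * ((y + 1 : ℕ) : ℝ)) + 1 * 1 * (((N / K + 1 : ℕ) : ℝ) * (((y + 1) / N : ℕ) : ℝ))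
      ≤ (200 * C' + 24) * y * (N : ℝ) ^ (-(η' / 2)) := by
    rw [hgi]
    have h2y : (y : ℝ) + 1 ≤ 2 * y := by linarith
    have h0 : 0 ≤ 100 * C' + 12 := by positivity
    have h3 := mul_le_mul_of_nonneg_right (mul_le_mul_of_nonneg_left h2y h0) hgi0.le
    have h4 := add_le_add hT1 hT2
    nlinarith [h3, h4]
  rw [← hident]
  exact hblock.trans hfin

end Summit.Parity.GeneralizedHardyLittlewood.Theorems.TypeIILiouville

end
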